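import Summits.QuantumFields.YangMills.Theorems.BalabanUVNodesN15KingModelCombesThomasClasses
import Summits.QuantumFields.YangMills.Theorems.BalabanUVNodesN15KingModelCovariantBlockFieldCovariance
import HarnessLib

/-!
# BalabanUVNodes ∕ N15 — THE KING-MODEL RUNG (PART Ϧ-e): KING's EFFECTIVE LAPLACIAN `Δ_eff(U) = a − a²Q(U)G(U)Q(U)^*` DECAYS AT EVERY COERCIVE LINK FIELD — King's (4.34)(ii) ∕ the tree's
# `King1986.Torus.effLaplacian_decay` shape `|Δ^{(k)}(b,b′)| ≤ C_Δe^{−κ·d(b,b′)}` with `C_Δ(κ) = a + a²(2∕κ)e²`, AT CURVED `U`: η-uniformly on the small-curvature class, with EXACTLY the tree's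
# constants `(CDelta a (d+1), kapA a (d+1))` at every pure gauge; the sandwich `Q(U)G(U)Q(U)^*` and the covariant minimiser `G(U)Q(U)^*` in Dimock's bilinear currency
# (Track A, DAG node N15 = NE2; FAN-OUT v1.1 §N15 s3 «KING-MODEL RUNG … + what the curved case adds»; count-neutral)

EDITION v1.1 (g51, DOC-ONLY, ERRATUM-Ϧ2 after ref-I READ-1087 NITs N1–N3: header §5 line removed (the theorem named there lives in PART Ϧ-j), `norm_conjTranspose_covQ_mulVec_sq` named as proved, locator (2.15)–(2.17) = p.653 ((2.18) = p.654); every declaration byte-identical to v1.0 p826848).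
HONEST FRAMING.  Count-neutral (cell `pub-ymgap`, seat `pub-ymgap-dag-n15-e` g50; `--supports stmt-QuantumFields-27247 --as helper` = K3ᴬ, KEY MAP v3).  King's one-level comparison model, King's
scaling `A₀(U) = L²(−Δ_U) + m² + aQ(U)^*Q(U)`, `Δ_eff(U) = a − a²Q(U)A₀(U)⁻¹Q(U)^*` ((2.14), PART Ϥ-k `effLapU`) with Bałaban's one-level covariant block mean; unitary `U`, any fibre.  The
`ℓ²`-Combes–Thomas currency is EXACT for these block objects (no short-distance loss: `Q(U)` and `Q(U)^*` carry `L^{∓(d+1)∕2}` and the sandwich is `O(1)`), whence the tree's `U ≡ 1` constants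
reappear verbatim.  For the minimiser `G(U)Q(U)^*` alone the `ℓ²` bound carries the η-normalisation `L^{(d+1)∕2}` of King's fine `L²` norm (stated, not hidden).  NOT the block-field COVARIANCE
`(Δ_eff(U))⁻¹` (done in PART Ϥ-l by domination, `m² > 0`); NOT Bałaban's multi-level objects; NOT a node discharge (N15 of record untouched); nothing continuum ∕ ℝ⁴ ∕ OS ∕ Clay.

THE RESULTS (`T` a tree contour system, `M` the block torus, `d_M = tdistT M`; HYPOTHESIS `κΣ‖v_x‖² ≤ Re⟨v,A₀(U)v⟩` (all `v`, `κ > 0`), `a ≥ 0`, `L ≥ 1`; `ctRate` = PART Ϧ-c):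
* §1 tools: `l2_opNorm_le_of_bilinear` (`|⟨u,Au′⟩| ≤ C‖u‖‖u′‖ ∀u,u′` ⟹ `‖A‖ ≤ C`), `star_dotProduct_submatrix_mulVec`∕`star_dotProduct_blk_mulVec` (`⟨u,(blk X y y′)u′⟩ = ⟨δ_y⊗u, X(δ_{y′}⊗u′)⟩`),
  `star_dotProduct_mul_mul_mulVec`,
  `norm_expWt_le_of_le` (`ψ ≤ t` on the support ⟹ `‖e^{ψ}v‖ ≤ e^{t}‖v‖`), `fib_conjTranspose_covQ_mulVec_siteVec` (support of `Q(U)ᴴ(δ_y⊗u)` ⊂ `B(y)`), `norm_conjTranspose_covQ_mulVec_sq`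
  (`‖Q(U)ᴴv‖² = L^{−(d+1)}‖v‖²`), `ctW_le_on_block`∕`ctW_ge_on_block` (the weight centred at the corner of `B(y′)`: `≤ κ_w` on `B(y′)`, `≥ κ_w·d_M(y,y′) − κ_w` on `B(y)`).
* §2 ★★★ **`norm_blk_sandwich_le`** — `‖blk (Q(U)G(U)Q(U)^*) y y′‖ ≤ (2∕κ)e²·e^{−ctRate(κ,a,d)·d_M(y,y′)}` (Dimock's Lemma 30 with `f = Q(U)ᴴ(δ_y⊗u)`, `g = Q(U)^*(δ_{y′}⊗u′)`, `‖f‖‖g‖ = ‖u‖‖u′‖`).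
* §3 ★★★★ **`norm_blk_effLapU_sub_le`** (`‖blk Δ_eff(U) y y′ − aδ_{yy′}1‖ ≤ a²(2∕κ)e²·e^{−ctRate·d_M(y,y′)}`), ★★★★ **`norm_blk_effLapU_le`** (`‖blk Δ_eff(U) y y′‖ ≤ (a + a²(2∕κ)e²)·e^{−ctRate·d_M(y,y′)}`
  — KING's (4.34)(ii) AT EVERY COERCIVE LINK FIELD, every `L ≥ 1`, every volume); classes: ★★★★ `norm_blk_effLapU_le_of_small_curvature` (η-UNIFORM, constants `(m²,a,d,ε₀)` only, every `L ≥ 2`),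
  ★★★ `norm_blk_effLapU_le_pureGauge` (`≤ CDelta a (d+1)·e^{−kapA a (d+1)·d_M(y,y′)}` — THE TREE's `effLaplacian_decay` CONSTANTS VERBATIM at every pure gauge and fibre), ★★★ `norm_blk_effLapU_le_every_U`.
* §4 ★★ `norm_blk_minimiser_le` — the covariant minimiser `G(U)Q(U)^*` (King's `ℋ = a·G Q^*`, [B9] Sect. D at one level): its `n × n` block `(G(U)Q(U)^*)_{[x],[y′]}` (`Matrix.submatrix`) has
  norm `≤ (2∕κ)·L^{(d+1)∕2}·e²·e^{−ctRate·d_M(B(x),y′)}`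
  — exponentially localised; the factor `L^{(d+1)∕2} = η^{−(d+1)∕2}` is the ratio of the fine `ℓ²` norm to King's `η`-weighted `L²` norm (an `ℓ²`-currency artefact, not a growth of `ℋ`).
* (no §5 in this file: the «what the curved case adds» conjunction for these objects is PART Ϧ-j's ★★★ `king_B9_thm31_objects_what_the_curved_case_adds`
  (`…CombesThomasPackage`); v1.0's header announced a §5 theorem that was moved there before filing — ERRATUM-Ϧ2, edition v1.1, declarations byte-identical.)
PRIOR TREE ART (by name): Ϧ-a (`siteVec` + lemmas), Ϧ-c (`ctRate` + lemmas, `norm_star_dotProduct_fullOpU_inv_mulVec_le_king`), Ϧ-d (floors), Ϥ-c (`covQ`, `covQ_apply_site`, `covQ_mul_conjTranspose`), Ϥ-d (`kingQadjU`,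
`fullOpU`), Ϥ-k (`effLapU`), `King1986.Torus` (`ctW`, `abs_ctW_block_le`, `mul_tdistT_blocks_le`, `CDelta`, `kapA`, `gamA`).  Dedup (rg at filing): basename 0 files; needles `norm_blk_sandwich_le|norm_blk_effLapU_le|
norm_blk_minimiser_le|l2_opNorm_le_of_bilinear` 0 tree files.  Locators: [King1986] (2.14) p.653, (4.34) p.674 «Δ^{(k)} has uniform exponential decay», (4.44)–(4.45) p.675; [Dimock2013] App. D Lemma 30 +
(coin)∕(Cbound) «Δ_k(Ω) = a_k − a_k²Q_kG_k(Ω)Q_k^T», «|C_k(Ω;y,y′)| ≤ O(1)L²e^{−δ₀L^{−2}d(y,y′)}»; [Balaban1985BackgroundPropagators] (3.19) p.393, (3.25)–(3.27) p.394–395, (3.133) (shape).  0 `sorry`, 0 `def`.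
-/

noncomputable section
open scoped BigOperators ComplexConjugate ComplexOrder InnerProductSpace Matrix.Norms.L2Operator
open Finset Matrix WithLp

namespace Summit.QuantumFields.YangMills.BalabanUVNodes.N15KingModelRung.CombesThomas

open Literature.MathematicalPhysics.QuantumFieldTheory.LatticeDiamagneticInequality (blk)
open Literature.MathematicalPhysics.QuantumFieldTheory.Balaban1983to89.B5Prop11Plancherel (Tor fine unitVec)
open Literature.MathematicalPhysics.QuantumFieldTheory.King1986.Torus
  (site blockOf blockOf_site blockEquiv blockEquiv_apply ctW abs_ctW_block_le tdistT tdistT_self tdistT_nonneg mul_tdistT_blocks_le exists_eq_site gamA gamA_pos kapA CDelta)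
open Summit.QuantumFields.YangMills.BalabanUVNodes.N15KingModelRung.Covariant (kingGaugeAct fib fib_apply norm_apply_le_norm_fib sum_norm_fib_sq norm_star_dotProduct_le)
open Summit.QuantumFields.YangMills.BalabanUVNodes.N15KingModelRung.Curvature (expWt norm_wt_apply)
open Summit.QuantumFields.YangMills.BalabanUVNodes.N15KingModelRung.Cover (kingPlaq)
open Summit.QuantumFields.YangMills.BalabanUVNodes.N15KingModelRung.CovariantBlock
  (BlockTree kingComb kingComb_depth_le covQ covQ_apply_site covQ_mul_conjTranspose kingQadjU fullOpU effLapU treeHol treeGap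
    re_quadForm_fullOpU_ge_uniform_of_small_curvature re_quadForm_fullOpU_pureGauge_ge_gamA pureGauge_mem_unitaryGroup re_quadForm_fullOpU_kingComb_ge treeGap_pos)

variable {d : ℕ} {L : ℕ} [NeZero L] (T : BlockTree d L) (M : Fin (d + 1) → ℕ) [hM : ∀ μ, NeZero (M μ)]
variable {𝕜 : Type*} [RCLike 𝕜] {n : Type*} [Fintype n] [DecidableEq n]

/-! ## §1 Tools: operator norms from bilinear bounds; supports and weights of the block test fields -/

section Tools

omit [NeZero L] hM in
/-- A bilinear bound gives the operator norm: `|⟨u, Au′⟩| ≤ C‖u‖‖u′‖` for all `u, u′` ⟹ `‖A‖ ≤ C` (`C ≥ 0`). [folklore] -/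
theorem l2_opNorm_le_of_bilinear (A : Matrix n n 𝕜) {C : ℝ} (hC : 0 ≤ C)
    (h : ∀ u u' : n → 𝕜, ‖star u ⬝ᵥ (A *ᵥ u')‖ ≤ C * ‖(toLp 2 u : EuclideanSpace 𝕜 n)‖ * ‖(toLp 2 u' : EuclideanSpace 𝕜 n)‖) : ‖A‖ ≤ C := by
  rw [Matrix.cstar_norm_def]
  refine ContinuousLinearMap.opNorm_le_bound _ hC fun w => ?_
  have hw : w = toLp 2 (ofLp w) := rfl
  rw [hw, Matrix.toEuclideanCLM_toLp]
  set v := A *ᵥ ofLp w with hv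
  have h1 : ‖(toLp 2 v : EuclideanSpace 𝕜 n)‖ ^ 2 ≤ C * ‖(toLp 2 v : EuclideanSpace 𝕜 n)‖ * ‖(toLp 2 (ofLp w) : EuclideanSpace 𝕜 n)‖ := by
    have h2 : ‖(toLp 2 v : EuclideanSpace 𝕜 n)‖ ^ 2 = RCLike.re (star v ⬝ᵥ v) := by
      rw [@norm_sq_eq_re_inner 𝕜, EuclideanSpace.inner_toLp_toLp, dotProduct_comm]
    rw [h2]
    exact (RCLike.re_le_norm _).trans (h v (ofLp w))
  by_cases hz : ‖(toLp 2 v : EuclideanSpace 𝕜 n)‖ = 0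
  · rw [hz]; positivity
  · have hpos : 0 < ‖(toLp 2 v : EuclideanSpace 𝕜 n)‖ := lt_of_le_of_ne (norm_nonneg _) (Ne.symm hz)
    nlinarith

omit [NeZero L] hM [DecidableEq n] in
/-- RECTANGULAR BLOCK PAIRING: for `X : (T_K × n) × (T_{K′} × n)`, `⟨u, X_{[x],[y′]}u′⟩ = ⟨δ_x ⊗ u, X(δ_{y′} ⊗ u′)⟩` with `X_{[x],[y′]} = X.submatrix (x,·) (y′,·)`. [folklore] -/
theorem star_dotProduct_submatrix_mulVec {K K' : Fin (d + 1) → ℕ} [∀ μ, NeZero (K μ)] [∀ μ, NeZero (K' μ)] (X : Matrix (Tor K × n) (Tor K' × n) 𝕜) (x : Tor K) (y' : Tor K')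
    (u u' : n → 𝕜) : star u ⬝ᵥ (X.submatrix (Prod.mk x) (Prod.mk y') *ᵥ u') = star (siteVec K x u) ⬝ᵥ (X *ᵥ siteVec K' y' u') := by
  have hcol : ∀ p, (X *ᵥ siteVec K' y' u') p = ∑ j, X p (y', j) * u' j := fun p => by
    rw [Matrix.mulVec, dotProduct, Fintype.sum_prod_type, Finset.sum_eq_single y']
    · simp only [siteVec, if_true]
    · intro b _ hb; exact Finset.sum_eq_zero fun j _ => by simp only [siteVec, if_neg hb, mul_zero]
    · intro h; exact absurd (Finset.mem_univ y') h
  symm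
  simp only [dotProduct]
  rw [Fintype.sum_prod_type, Finset.sum_eq_single x]
  · refine Finset.sum_congr rfl fun i _ => ?_
    rw [hcol (x, i)]
    simp only [Pi.star_apply, siteVec, if_true, Matrix.mulVec, dotProduct, Matrix.submatrix_apply]
  · intro b _ hb; exact Finset.sum_eq_zero fun i _ => by simp only [Pi.star_apply, siteVec, if_neg hb, star_zero, zero_mul]
  · intro h; exact absurd (Finset.mem_univ x) h

omit [NeZero L] [DecidableEq n] in
/-- `⟨u, (blk X y y′)u′⟩ = ⟨δ_y ⊗ u, X(δ_{y′} ⊗ u′)⟩` (block torus fields). [folklore] -/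
theorem star_dotProduct_blk_mulVec (X : Matrix (Tor M × n) (Tor M × n) 𝕜) (y y' : Tor M) (u u' : n → 𝕜) :
    star u ⬝ᵥ (blk X y y' *ᵥ u') = star (siteVec M y u) ⬝ᵥ (X *ᵥ siteVec M y' u') :=
  star_dotProduct_submatrix_mulVec X y y' u u'

omit [NeZero L] hM [DecidableEq n] in
/-- `⟨v, (QBR)w⟩ = ⟨Qᴴv, B(Rw)⟩`. [folklore] -/
theorem star_dotProduct_mul_mul_mulVec {α β : Type*} [Fintype α] [Fintype β] (Q : Matrix α β 𝕜) (B : Matrix β β 𝕜) (R : Matrix β α 𝕜) (v w : α → 𝕜) :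
    star v ⬝ᵥ ((Q * B * R) *ᵥ w) = star (Qᴴ *ᵥ v) ⬝ᵥ (B *ᵥ (R *ᵥ w)) := by
  rw [← mulVec_mulVec, ← mulVec_mulVec, dotProduct_mulVec, star_mulVec, conjTranspose_conjTranspose]

omit [NeZero L] hM [DecidableEq n] in
/-- WEIGHTS ON A SUPPORT: if `ψ ≤ t` wherever `v` has a non-zero fibre then `‖e^{ψ}v‖ ≤ e^{t}‖v‖`. [folklore] -/
theorem norm_expWt_le_of_le {K : Fin (d + 1) → ℕ} [∀ μ, NeZero (K μ)] (ψ : Tor K → ℝ) (v : Tor K × n → 𝕜) {t : ℝ} (h : ∀ x, fib K v x ≠ 0 → ψ x ≤ t) :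
    ‖(toLp 2 (expWt K ψ v) : EuclideanSpace 𝕜 (Tor K × n))‖ ≤ Real.exp t * ‖(toLp 2 v : EuclideanSpace 𝕜 (Tor K × n))‖ := by
  have hsq : ‖(toLp 2 (expWt K ψ v) : EuclideanSpace 𝕜 (Tor K × n))‖ ^ 2 ≤ (Real.exp t * ‖(toLp 2 v : EuclideanSpace 𝕜 (Tor K × n))‖) ^ 2 := by
    rw [mul_pow, ← sum_norm_fib_sq, ← sum_norm_fib_sq, Finset.mul_sum]
    refine Finset.sum_le_sum fun x _ => ?_
    have hfib : ‖fib K (expWt K ψ v) x‖ = Real.exp (ψ x) * ‖fib K v x‖ := by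
      rw [fib_expWt, norm_smul, RCLike.norm_ofReal, abs_of_pos (Real.exp_pos _)]
    rw [hfib, mul_pow]
    by_cases hz : fib K v x = 0
    · rw [hz, norm_zero]; simp
    · exact mul_le_mul_of_nonneg_right (pow_le_pow_left₀ (Real.exp_nonneg _) (Real.exp_le_exp.mpr (h x hz)) 2) (sq_nonneg _)
  exact abs_le_of_sq_le_sq' hsq (by positivity) |>.2

/-- THE TEST FIELD `Q(U)ᴴ(δ_y ⊗ u)` LIVES ON THE BLOCK `B(y)`: its fibre at `site b j` vanishes for `b ≠ y`. [cite: Balaban1985BackgroundPropagators, (3.19) p.393] -/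
theorem fib_conjTranspose_covQ_mulVec_siteVec (U : Tor (fine L M) × Fin (d + 1) → Matrix n n 𝕜) (y : Tor M) (u : n → 𝕜) {x : Tor (fine L M)} (hx : blockOf L M x ≠ y) :
    fib (fine L M) ((covQ T M U)ᴴ *ᵥ siteVec M y u) x = 0 := by
  obtain ⟨j, hj⟩ := exists_eq_site L M x
  ext k
  rw [fib_apply, hj, Matrix.mulVec, dotProduct, Fintype.sum_prod_type, Finset.sum_eq_single y]
  · refine (Finset.sum_eq_zero fun i _ => ?_).trans rfl
    rw [Matrix.conjTranspose_apply, covQ_apply_site, if_neg (Ne.symm hx), star_zero, zero_mul]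
  · intro b _ hb; exact Finset.sum_eq_zero fun i _ => by simp only [siteVec, if_neg hb, mul_zero]
  · intro h; exact absurd (Finset.mem_univ y) h

/-- `‖Q(U)ᴴv‖² = L^{−(d+1)}‖v‖²` for unitary `U` (`Q(U)Q(U)ᴴ = L^{−(d+1)}·1`, PART Ϥ-c). [cite: Balaban1985BackgroundPropagators, (3.19) p.393; King1986, (4.1)–(4.3) p.670] -/
theorem norm_conjTranspose_covQ_mulVec_sq {U : Tor (fine L M) × Fin (d + 1) → Matrix n n 𝕜} (hU : ∀ bd, U bd ∈ Matrix.unitaryGroup n 𝕜) (v : Tor M × n → 𝕜) :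
    ‖(toLp 2 ((covQ T M U)ᴴ *ᵥ v) : EuclideanSpace 𝕜 (Tor (fine L M) × n))‖ ^ 2 = ((L : ℝ) ^ (d + 1))⁻¹ * ‖(toLp 2 v : EuclideanSpace 𝕜 (Tor M × n))‖ ^ 2 := by
  have h1 : ‖(toLp 2 ((covQ T M U)ᴴ *ᵥ v) : EuclideanSpace 𝕜 (Tor (fine L M) × n))‖ ^ 2 = RCLike.re (star v ⬝ᵥ ((covQ T M U * (covQ T M U)ᴴ) *ᵥ v)) := by
    rw [@norm_sq_eq_re_inner 𝕜, EuclideanSpace.inner_toLp_toLp, dotProduct_comm]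
    congr 1
    rw [star_mulVec, conjTranspose_conjTranspose, ← dotProduct_mulVec, mulVec_mulVec]
  have h2 : ‖(toLp 2 v : EuclideanSpace 𝕜 (Tor M × n))‖ ^ 2 = RCLike.re (star v ⬝ᵥ v) := by
    rw [@norm_sq_eq_re_inner 𝕜, EuclideanSpace.inner_toLp_toLp, dotProduct_comm]
  rw [h1, h2, covQ_mul_conjTranspose T M hU, Matrix.smul_mulVec, Matrix.one_mulVec, dotProduct_smul, smul_eq_mul]
  have hc : ((L : 𝕜) ^ (d + 1))⁻¹ = ((((L : ℝ) ^ (d + 1))⁻¹ : ℝ) : 𝕜) := by push_cast; ring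
  rw [hc, RCLike.re_ofReal_mul]

/-- ON THE CENTRE's BLOCK THE WEIGHT IS `≤ κ_w`: for `x ∈ B(y′)` and the centre `(site L M y' T.root) = site y′ j₀`, `ctW κ_w (site L M y' T.root) x ≤ κ_w` (`κ_w ≥ 0`). [folklore] -/
theorem ctW_le_on_block {κw : ℝ} (hκw : 0 ≤ κw) (y' : Tor M) (j₀ : Fin (d + 1) → Fin L) {x : Tor (fine L M)} (hx : blockOf L M x = y') :
    ctW L M κw (site L M y' j₀) x ≤ κw := by
  have h := abs_ctW_block_le L M hκw (site L M y' j₀) x (site L M y' j₀) (by rw [hx, blockOf_site])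
  rw [show ctW L M κw (site L M y' j₀) (site L M y' j₀) = 0 by rw [ctW, tdistT_self, mul_zero], sub_zero] at h
  exact (le_abs_self _).trans h

/-- ON ANOTHER BLOCK THE WEIGHT IS `≥ κ_w·d_M(y,y′) − κ_w`: for `x ∈ B(y)` and the centre `(site L M y' T.root) = site y′ j₀`, `κ_w·d_M(y,y′) − κ_w ≤ ctW κ_w (site L M y' T.root) x` (`κ_w ≥ 0`, the tree's `mul_tdistT_blocks_le`). [folklore] -/
theorem ctW_ge_on_block (hL : 1 ≤ L) {κw : ℝ} (hκw : 0 ≤ κw) (y y' : Tor M) (j₀ : Fin (d + 1) → Fin L) {x : Tor (fine L M)} (hx : blockOf L M x = y) :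
    κw * tdistT M y y' - κw ≤ ctW L M κw (site L M y' j₀) x := by
  have hL0 : (0 : ℝ) < L := by exact_mod_cast hL
  obtain ⟨j, hj⟩ := exists_eq_site L M x
  rw [hx] at hj
  have hb : (L : ℝ) * tdistT M y y' ≤ tdistT (fine L M) x (site L M y' j₀) + ((L : ℝ) - 1) := by rw [hj]; exact mul_tdistT_blocks_le L M y y' j j₀
  rw [ctW]
  have h1 : κw * tdistT M y y' ≤ κw / L * tdistT (fine L M) x (site L M y' j₀) + κw * (((L : ℝ) - 1) / L) := by
    have := mul_le_mul_of_nonneg_left hb (div_nonneg hκw hL0.le)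
    calc κw * tdistT M y y' = κw / L * ((L : ℝ) * tdistT M y y') := by field_simp
      _ ≤ κw / L * (tdistT (fine L M) x (site L M y' j₀) + ((L : ℝ) - 1)) := this
      _ = κw / L * tdistT (fine L M) x (site L M y' j₀) + κw * (((L : ℝ) - 1) / L) := by ring
  have h2 : κw * (((L : ℝ) - 1) / L) ≤ κw := by
    have h4 : ((L : ℝ) - 1) / L ≤ 1 := by rw [div_le_one hL0]; linarith
    nlinarith
  linarith
end Tools

/-! ## §2 The sandwich `Q(U)G(U)Q(U)^*` -/

section Sandwich

variable {a : ℝ} (ha : 0 ≤ a) (m2 : ℝ) {U : Tor (fine L M) × Fin (d + 1) → Matrix n n 𝕜} (hU : ∀ bd, U bd ∈ Matrix.unitaryGroup n 𝕜)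
  {κ : ℝ} (hκ : 0 < κ) (hcoer : ∀ v : Tor (fine L M) × n → 𝕜, κ * ∑ x, ‖fib (fine L M) v x‖ ^ 2 ≤ RCLike.re (star v ⬝ᵥ (fullOpU T M a ((L : ℝ) ^ 2) m2 U *ᵥ v)))
include ha hU hκ hcoer

/-- ★★★ **THE SANDWICH DECAYS ON THE BLOCK SCALE**: `‖blk (Q(U)G(U)Q(U)^*) y y′‖ ≤ (2∕κ)·e²·e^{−ctRate(κ,a,d)·d_M(y,y′)}` for every `L ≥ 1`, every volume, every unitary `U` with a `κ`-coercive `A₀(U)`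
— Dimock's Lemma 30 with `f = Q(U)ᴴ(δ_y⊗u)` on `B(y)`, `g = Q(U)^*(δ_{y′}⊗u′)` on `B(y′)`, `‖f‖‖g‖ = ‖u‖‖u′‖`. [cite: Dimock2013, App. D, Lemma 30, (coin); King1986, (2.14) p.653, (4.34) p.674] -/
theorem norm_blk_sandwich_le (hL : 1 ≤ L) (y y' : Tor M) :
    ‖blk (covQ T M U * (fullOpU T M a ((L : ℝ) ^ 2) m2 U)⁻¹ * kingQadjU T M U) y y'‖ ≤ 2 / κ * Real.exp 2 * Real.exp (-(ctRate κ a d * tdistT M y y')) := by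
  set δ := ctRate κ a d with hδ
  have hδ0 : 0 ≤ δ := ctRate_nonneg κ a d
  have hδ1 : δ ≤ 1 := ctRate_le_one κ a d
  set G := (fullOpU T M a ((L : ℝ) ^ 2) m2 U)⁻¹ with hG
  have hLr0 : (0 : ℝ) < (L : ℝ) ^ (d + 1) := by have : (0 : ℝ) < L := (by exact_mod_cast hL); positivity
  refine l2_opNorm_le_of_bilinear _ (by positivity) fun u u' => ?_
  -- the two test fields
  set f : Tor (fine L M) × n → 𝕜 := (covQ T M U)ᴴ *ᵥ siteVec M y u with hf
  set g : Tor (fine L M) × n → 𝕜 := kingQadjU T M U *ᵥ siteVec M y' u' with hg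
  have hpair : star u ⬝ᵥ (blk (covQ T M U * G * kingQadjU T M U) y y' *ᵥ u') = star f ⬝ᵥ (G *ᵥ g) := by
    rw [star_dotProduct_blk_mulVec, star_dotProduct_mul_mul_mulVec]
  -- Dimock's Lemma 30
  have hD := norm_star_dotProduct_fullOpU_inv_mulVec_le_king T M ha m2 hU hκ hcoer hL (site L M y' T.root) f g
  -- the weighted norms of the test fields
  have hg' : g = (((L : ℝ) ^ (d + 1) : ℝ) : 𝕜) • ((covQ T M U)ᴴ *ᵥ siteVec M y' u') := by
    rw [hg, kingQadjU, Matrix.smul_mulVec]; push_cast; rfl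
  have hfw : ‖(toLp 2 (expWt (fine L M) (fun x => -ctW L M δ (site L M y' T.root) x) f) : EuclideanSpace 𝕜 (Tor (fine L M) × n))‖
      ≤ Real.exp (δ - δ * tdistT M y y') * ‖(toLp 2 f : EuclideanSpace 𝕜 (Tor (fine L M) × n))‖ := by
    refine norm_expWt_le_of_le _ f fun x hx => ?_
    have hbx : blockOf L M x = y := by
      by_contra hne; exact hx (fib_conjTranspose_covQ_mulVec_siteVec T M U y u hne)
    have := ctW_ge_on_block (L := L) M hL hδ0 y y' T.root hbx
    linarith
  have hgw : ‖(toLp 2 (expWt (fine L M) (ctW L M δ (site L M y' T.root)) g) : EuclideanSpace 𝕜 (Tor (fine L M) × n))‖ ≤ Real.exp δ * ‖(toLp 2 g : EuclideanSpace 𝕜 (Tor (fine L M) × n))‖ := by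
    refine norm_expWt_le_of_le _ g fun x hx => ?_
    have hbx : blockOf L M x = y' := by
      by_contra hne
      apply hx
      have h0 := fib_conjTranspose_covQ_mulVec_siteVec T M U y' u' hne
      have h0' : ∀ k, ((covQ T M U)ᴴ *ᵥ siteVec M y' u') (x, k) = 0 := fun k => by
        have := congr_fun (congrArg ofLp h0) k
        simpa only [fib, WithLp.ofLp_toLp, WithLp.ofLp_zero, Pi.zero_apply] using this
      ext k
      rw [fib_apply, hg', Pi.smul_apply, smul_eq_mul, h0', mul_zero]; rfl
    exact ctW_le_on_block (L := L) M hδ0 y' T.root hbx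
  -- `‖f‖‖g‖ = ‖u‖‖u′‖`
  have hfg : ‖(toLp 2 f : EuclideanSpace 𝕜 (Tor (fine L M) × n))‖ * ‖(toLp 2 g : EuclideanSpace 𝕜 (Tor (fine L M) × n))‖
      = ‖(toLp 2 u : EuclideanSpace 𝕜 n)‖ * ‖(toLp 2 u' : EuclideanSpace 𝕜 n)‖ := by
    have h1 := norm_conjTranspose_covQ_mulVec_sq T M hU (siteVec M y u)
    have h2 := norm_conjTranspose_covQ_mulVec_sq T M hU (siteVec M y' u')
    rw [norm_siteVec] at h1 h2
    have hgn : ‖(toLp 2 g : EuclideanSpace 𝕜 (Tor (fine L M) × n))‖ = (L : ℝ) ^ (d + 1) * ‖(toLp 2 ((covQ T M U)ᴴ *ᵥ siteVec M y' u') : EuclideanSpace 𝕜 (Tor (fine L M) × n))‖ := by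
      rw [hg', WithLp.toLp_smul, norm_smul, RCLike.norm_ofReal, abs_of_pos hLr0]
    have hprod_sq : (‖(toLp 2 f : EuclideanSpace 𝕜 (Tor (fine L M) × n))‖ * ‖(toLp 2 g : EuclideanSpace 𝕜 (Tor (fine L M) × n))‖) ^ 2
        = (‖(toLp 2 u : EuclideanSpace 𝕜 n)‖ * ‖(toLp 2 u' : EuclideanSpace 𝕜 n)‖) ^ 2 := by
      rw [mul_pow, mul_pow, hgn, mul_pow, hf, h1, h2]
      field_simp
    exact (sq_eq_sq₀ (by positivity) (by positivity)).mp hprod_sq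
  -- assemble
  rw [hpair]
  calc ‖star f ⬝ᵥ (G *ᵥ g)‖
      ≤ 2 / κ * ‖(toLp 2 (expWt (fine L M) (fun x => -ctW L M δ (site L M y' T.root) x) f) : EuclideanSpace 𝕜 (Tor (fine L M) × n))‖
          * ‖(toLp 2 (expWt (fine L M) (ctW L M δ (site L M y' T.root)) g) : EuclideanSpace 𝕜 (Tor (fine L M) × n))‖ := hD
    _ ≤ 2 / κ * (Real.exp (δ - δ * tdistT M y y') * ‖(toLp 2 f : EuclideanSpace 𝕜 (Tor (fine L M) × n))‖)
          * (Real.exp δ * ‖(toLp 2 g : EuclideanSpace 𝕜 (Tor (fine L M) × n))‖) := by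
        gcongr
    _ = 2 / κ * (Real.exp (δ - δ * tdistT M y y') * Real.exp δ) * (‖(toLp 2 f : EuclideanSpace 𝕜 (Tor (fine L M) × n))‖ * ‖(toLp 2 g : EuclideanSpace 𝕜 (Tor (fine L M) × n))‖) := by ring
    _ ≤ 2 / κ * (Real.exp 2 * Real.exp (-(δ * tdistT M y y'))) * (‖(toLp 2 u : EuclideanSpace 𝕜 n)‖ * ‖(toLp 2 u' : EuclideanSpace 𝕜 n)‖) := by
        rw [hfg, ← Real.exp_add, ← Real.exp_add]
        exact mul_le_mul_of_nonneg_right (mul_le_mul_of_nonneg_left (Real.exp_le_exp.mpr (by linarith)) (by positivity)) (by positivity)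
    _ = 2 / κ * Real.exp 2 * Real.exp (-(ctRate κ a d * tdistT M y y')) * ‖(toLp 2 u : EuclideanSpace 𝕜 n)‖ * ‖(toLp 2 u' : EuclideanSpace 𝕜 n)‖ := by ring

/-! ## §3 King's effective Laplacian `Δ_eff(U)` at every coercive link field -/

omit hκ hcoer ha hU in
/-- The blocks of `Δ_eff(U)`: `blk Δ_eff(U) y y′ = aδ_{yy′}1 − a²·blk (Q(U)G(U)Q(U)^*) y y′`. [cite: King1986, (2.14) p.653] -/
theorem blk_effLapU (y y' : Tor M) :
    blk (effLapU T M a ((L : ℝ) ^ 2) m2 U) y y' = (if y = y' then (a : 𝕜) else 0) • (1 : Matrix n n 𝕜)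
      - ((a ^ 2 : ℝ) : 𝕜) • blk (covQ T M U * (fullOpU T M a ((L : ℝ) ^ 2) m2 U)⁻¹ * kingQadjU T M U) y y' := by
  ext i i'
  simp only [effLapU, blk, Matrix.of_apply, Matrix.sub_apply, Matrix.smul_apply, Matrix.one_apply, Prod.mk.injEq, smul_eq_mul]
  by_cases h : y = y' <;> by_cases h' : i = i' <;> simp [h, h']

/-- ★★★★ **KING's (4.34)(ii) AT EVERY COERCIVE LINK FIELD — off the diagonal**: `‖blk Δ_eff(U) y y′ − aδ_{yy′}1‖ ≤ a²(2∕κ)e²·e^{−ctRate(κ,a,d)·d_M(y,y′)}` for every `L ≥ 1`, every volume, every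
unitary `U` with a `κ`-coercive `A₀(U)`. [cite: King1986, (2.14) p.653, (4.34) p.674; Dimock2013, App. D, (coin)] -/
theorem norm_blk_effLapU_sub_le (hL : 1 ≤ L) (y y' : Tor M) :
    ‖blk (effLapU T M a ((L : ℝ) ^ 2) m2 U) y y' - (if y = y' then (a : 𝕜) else 0) • (1 : Matrix n n 𝕜)‖
      ≤ a ^ 2 * (2 / κ * Real.exp 2) * Real.exp (-(ctRate κ a d * tdistT M y y')) := by
  rw [blk_effLapU, sub_sub_cancel_left, norm_neg, norm_smul, RCLike.norm_ofReal, abs_of_nonneg (sq_nonneg a), mul_assoc]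
  exact mul_le_mul_of_nonneg_left (by have := norm_blk_sandwich_le T M ha m2 hU hκ hcoer hL y y'; linarith) (sq_nonneg a)

/-- ★★★★ **KING's (4.34)(ii) AT EVERY COERCIVE LINK FIELD**: `‖blk Δ_eff(U) y y′‖ ≤ (a + a²(2∕κ)e²)·e^{−ctRate(κ,a,d)·d_M(y,y′)}` — the tree's `CDelta`∕`kapA` shape `C_Δ = a + a²(2∕γ_A)e²` with `γ_A ↦ κ`,
for every `L ≥ 1`, every volume, every fibre, every unitary `U` with a `κ`-coercive `A₀(U)`. [cite: King1986, (4.34) p.674; Dimock2013, App. D, Lemma 30, (coin), (Cbound)] -/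
theorem norm_blk_effLapU_le (hL : 1 ≤ L) (y y' : Tor M) :
    ‖blk (effLapU T M a ((L : ℝ) ^ 2) m2 U) y y'‖ ≤ (a + a ^ 2 * (2 / κ) * Real.exp 2) * Real.exp (-(ctRate κ a d * tdistT M y y')) := by
  have h1 := norm_blk_effLapU_sub_le T M ha m2 hU hκ hcoer hL y y'
  have hdiag : ‖(if y = y' then (a : 𝕜) else 0) • (1 : Matrix n n 𝕜)‖ ≤ a * Real.exp (-(ctRate κ a d * tdistT M y y')) := by
    by_cases h : y = y'
    · subst h
      rw [if_pos rfl, tdistT_self, mul_zero, neg_zero, Real.exp_zero, mul_one, norm_smul, RCLike.norm_ofReal, abs_of_nonneg ha]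
      have hone : ‖(1 : Matrix n n 𝕜)‖ ≤ 1 := by
        rw [Matrix.cstar_norm_def, map_one]; exact ContinuousLinearMap.norm_id_le
      calc a * ‖(1 : Matrix n n 𝕜)‖ ≤ a * 1 := mul_le_mul_of_nonneg_left hone ha
        _ = a := mul_one a
    · rw [if_neg h, zero_smul, norm_zero]; positivity
  calc ‖blk (effLapU T M a ((L : ℝ) ^ 2) m2 U) y y'‖
      ≤ ‖blk (effLapU T M a ((L : ℝ) ^ 2) m2 U) y y' - (if y = y' then (a : 𝕜) else 0) • (1 : Matrix n n 𝕜)‖ + ‖(if y = y' then (a : 𝕜) else 0) • (1 : Matrix n n 𝕜)‖ :=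
        norm_le_norm_sub_add _ _
    _ ≤ a ^ 2 * (2 / κ * Real.exp 2) * Real.exp (-(ctRate κ a d * tdistT M y y')) + a * Real.exp (-(ctRate κ a d * tdistT M y y')) := add_le_add h1 hdiag
    _ = (a + a ^ 2 * (2 / κ) * Real.exp 2) * Real.exp (-(ctRate κ a d * tdistT M y y')) := by ring
end Sandwich

/-! ## §3b The classes -/

section Classes

/-- ★★★★ **`η`-UNIFORM DECAY OF KING's EFFECTIVE LAPLACIAN AT SMALL CURVATURE**: comb contours, `a ≥ 0`, `κ₀ = m² + min(a,(2(d+1))⁻¹) − (d+1)d²ε₀² > 0`; for every `L ≥ 2`, every volume, every unitary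
`U` with plaquettes `‖P_U − 1‖ ≤ ε₀∕L²`:  `‖blk Δ_eff(U) y y′‖ ≤ (a + a²(2∕κ₀)e²)·e^{−ctRate(κ₀,a,d)·d_M(y,y′)}` — constants depending on `(m², a, d, ε₀)` ONLY.
[cite: King1986, (4.34) p.674; Balaban1985BackgroundPropagators, Thm 3.1 p.397, (3.35) p.396; Dimock2013, App. D, (coin)] -/
theorem norm_blk_effLapU_le_of_small_curvature (hL : 2 ≤ L) {a : ℝ} (ha : 0 ≤ a) (m2 : ℝ) {U : Tor (fine L M) × Fin (d + 1) → Matrix n n 𝕜} (hU : ∀ bd, U bd ∈ Matrix.unitaryGroup n 𝕜)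
    {ε₀ : ℝ} (hε : ∀ (x : Tor (fine L M)) (κ ρ : Fin (d + 1)), ‖kingPlaq (fine L M) U x κ ρ - 1‖ ≤ ε₀ / (L : ℝ) ^ 2)
    (hκ₀ : 0 < m2 + min a (1 / (2 * ((d : ℝ) + 1))) - ((d : ℝ) + 1) * (d : ℝ) ^ 2 * ε₀ ^ 2) (y y' : Tor M) :
    ‖blk (effLapU (kingComb d L) M a ((L : ℝ) ^ 2) m2 U) y y'‖
      ≤ (a + a ^ 2 * (2 / (m2 + min a (1 / (2 * ((d : ℝ) + 1))) - ((d : ℝ) + 1) * (d : ℝ) ^ 2 * ε₀ ^ 2)) * Real.exp 2)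
        * Real.exp (-(ctRate (m2 + min a (1 / (2 * ((d : ℝ) + 1))) - ((d : ℝ) + 1) * (d : ℝ) ^ 2 * ε₀ ^ 2) a d * tdistT M y y')) :=
  norm_blk_effLapU_le (kingComb d L) M ha m2 hU hκ₀ (re_quadForm_fullOpU_ge_uniform_of_small_curvature M hL a m2 hU hε) (by omega) y y'

/-- ★★★ **AT EVERY PURE GAUGE: THE TREE's CONSTANTS VERBATIM** — `‖blk Δ_eff(g·1·g^*) y y′‖ ≤ CDelta a (d+1)·e^{−kapA a (d+1)·d_M(y,y′)}` for `a > 0`, `m² ≥ 0`, every `L ≥ 1`, every volume, every tree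
contour system, every unitary gauge `g`, every fibre (`King1986.Torus.effLaplacian_decay`: `|Δ^{(k)}(b,b′)| ≤ C_Δe^{−κ_A·d(b,b′)}` at `U ≡ 1`, scalar).
[cite: King1986, (4.34) p.674; Dimock2013, App. D, Lemma 30, (Cbound); Balaban1985BackgroundPropagators, (3.34) p.396] -/
theorem norm_blk_effLapU_le_pureGauge (hL : 1 ≤ L) {a m2 : ℝ} (ha : 0 < a) (hm : 0 ≤ m2) {g : Tor (fine L M) → Matrix n n 𝕜} (hg : ∀ x, g x ∈ Matrix.unitaryGroup n 𝕜) (y y' : Tor M) :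
    ‖blk (effLapU T M a ((L : ℝ) ^ 2) m2 (kingGaugeAct (fine L M) g fun _ => (1 : Matrix n n 𝕜))) y y'‖ ≤ CDelta a (d + 1) * Real.exp (-(kapA a (d + 1) * tdistT M y y')) := by
  rw [CDelta, ← ctRate_gamA]
  exact norm_blk_effLapU_le T M ha.le m2 (pureGauge_mem_unitaryGroup (L := L) M hg) (gamA_pos ha (d + 1)) (re_quadForm_fullOpU_pureGauge_ge_gamA T M hL ha.le hm hg) hL y y'

/-- ★★★ **AT EVERY UNITARY LINK FIELD** (comb, `a > 0`, `m² ≥ 0`, `L ≥ 2`, no regularity): `‖blk Δ_eff(U) y y′‖ ≤ (a + a²(2∕κ_T)e²)·e^{−ctRate(κ_T,a,d)·d_M(y,y′)}`, `κ_T = m² + min(a, L²∕(L^{d+1}(d+1)(L−1)))`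
— volume-free, `U`-free, `L`-dependent. [cite: King1986, (2.14) p.653, (4.34) p.674; Balaban1985BackgroundPropagators, p.395 l.1–3] -/
theorem norm_blk_effLapU_le_every_U (hL : 2 ≤ L) {a m2 : ℝ} (ha : 0 < a) (hm : 0 ≤ m2) {U : Tor (fine L M) × Fin (d + 1) → Matrix n n 𝕜} (hU : ∀ bd, U bd ∈ Matrix.unitaryGroup n 𝕜)
    (y y' : Tor M) :
    ‖blk (effLapU (kingComb d L) M a ((L : ℝ) ^ 2) m2 U) y y'‖
      ≤ (a + a ^ 2 * (2 / (m2 + treeGap a ((L : ℝ) ^ 2) L d ((d + 1) * (L - 1)))) * Real.exp 2)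
        * Real.exp (-(ctRate (m2 + treeGap a ((L : ℝ) ^ 2) L d ((d + 1) * (L - 1))) a d * tdistT M y y')) := by
  have hL0 : (0 : ℝ) < L := by exact_mod_cast (show 0 < L by omega)
  have := treeGap_pos (L := L) (D := (d + 1) * (L - 1)) ha (by positivity : (0 : ℝ) < (L : ℝ) ^ 2) (Nat.mul_pos (Nat.succ_pos d) (by omega)) d
  exact norm_blk_effLapU_le (kingComb d L) M ha.le m2 hU (by linarith) (re_quadForm_fullOpU_kingComb_ge M (by positivity) a m2 hU) (by omega) y y'
end Classes

/-! ## §4 The covariant minimiser `G(U)Q(U)^*` -/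

section Minimiser

variable {a : ℝ} (ha : 0 ≤ a) (m2 : ℝ) {U : Tor (fine L M) × Fin (d + 1) → Matrix n n 𝕜} (hU : ∀ bd, U bd ∈ Matrix.unitaryGroup n 𝕜)
  {κ : ℝ} (hκ : 0 < κ) (hcoer : ∀ v : Tor (fine L M) × n → 𝕜, κ * ∑ x, ‖fib (fine L M) v x‖ ^ 2 ≤ RCLike.re (star v ⬝ᵥ (fullOpU T M a ((L : ℝ) ^ 2) m2 U *ᵥ v)))
include ha hU hκ hcoer

/-- ★★ **THE COVARIANT MINIMISER IS EXPONENTIALLY LOCALISED**: `‖blk (G(U)Q(U)^*) x y′‖ ≤ (2∕κ)·L^{(d+1)∕2}·e²·e^{−ctRate(κ,a,d)·d_M(B(x),y′)}` for every `L ≥ 1`, every volume, every unitary `U` with a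
`κ`-coercive `A₀(U)` (King's minimiser is `ℋ(U) = a·G(U)Q(U)^*`; the factor `L^{(d+1)∕2} = η^{−(d+1)∕2}` converts the fine `ℓ²` norm into King's `η`-weighted `L²` norm — as an operator from block
fields to fine fields in King's norms `ℋ(U)` is `η`-uniformly bounded). [cite: King1986, (2.15)–(2.17) p.653, (2.18) p.654, (4.44) p.675; Balaban1985BackgroundPropagators, (3.133) Sect. D (shape)] -/
theorem norm_blk_minimiser_le (hL : 1 ≤ L) (x : Tor (fine L M)) (y' : Tor M) :
    ‖((fullOpU T M a ((L : ℝ) ^ 2) m2 U)⁻¹ * kingQadjU T M U).submatrix (Prod.mk x) (Prod.mk y')‖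
      ≤ 2 / κ * Real.sqrt ((L : ℝ) ^ (d + 1)) * Real.exp 2 * Real.exp (-(ctRate κ a d * tdistT M (blockOf L M x) y')) := by
  set δ := ctRate κ a d with hδ
  have hδ0 : 0 ≤ δ := ctRate_nonneg κ a d
  have hδ1 : δ ≤ 1 := ctRate_le_one κ a d
  set G := (fullOpU T M a ((L : ℝ) ^ 2) m2 U)⁻¹ with hG
  have hLr0 : (0 : ℝ) < (L : ℝ) ^ (d + 1) := by have : (0 : ℝ) < L := (by exact_mod_cast hL); positivity
  refine l2_opNorm_le_of_bilinear _ (by positivity) fun u u' => ?_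
  set f : Tor (fine L M) × n → 𝕜 := siteVec (fine L M) x u with hf
  set g : Tor (fine L M) × n → 𝕜 := kingQadjU T M U *ᵥ siteVec M y' u' with hg
  have hpair : star u ⬝ᵥ ((G * kingQadjU T M U).submatrix (Prod.mk x) (Prod.mk y') *ᵥ u') = star f ⬝ᵥ (G *ᵥ g) := by
    rw [star_dotProduct_submatrix_mulVec, ← mulVec_mulVec]
  have hD := norm_star_dotProduct_fullOpU_inv_mulVec_le_king T M ha m2 hU hκ hcoer hL (site L M y' T.root) f g
  have hg' : g = (((L : ℝ) ^ (d + 1) : ℝ) : 𝕜) • ((covQ T M U)ᴴ *ᵥ siteVec M y' u') := by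
    rw [hg, kingQadjU, Matrix.smul_mulVec]; push_cast; rfl
  -- weights: `f` sits at `x ∈ B(blockOf x)`, `g` on `B(y′)`
  have hfw : ‖(toLp 2 (expWt (fine L M) (fun z => -ctW L M δ (site L M y' T.root) z) f) : EuclideanSpace 𝕜 (Tor (fine L M) × n))‖
      ≤ Real.exp (δ - δ * tdistT M (blockOf L M x) y') * ‖(toLp 2 f : EuclideanSpace 𝕜 (Tor (fine L M) × n))‖ := by
    refine norm_expWt_le_of_le _ f fun z hz => ?_
    have hzx : z = x := by by_contra hne; exact hz (by rw [hf, fib_siteVec, if_neg hne])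
    have := ctW_ge_on_block (L := L) M hL hδ0 (blockOf L M x) y' T.root (x := z) (by rw [hzx])
    linarith
  have hgw : ‖(toLp 2 (expWt (fine L M) (ctW L M δ (site L M y' T.root)) g) : EuclideanSpace 𝕜 (Tor (fine L M) × n))‖ ≤ Real.exp δ * ‖(toLp 2 g : EuclideanSpace 𝕜 (Tor (fine L M) × n))‖ := by
    refine norm_expWt_le_of_le _ g fun z hz => ?_
    have hbz : blockOf L M z = y' := by
      by_contra hne
      apply hz
      have h0 := fib_conjTranspose_covQ_mulVec_siteVec T M U y' u' hne
      have h0' : ∀ k, ((covQ T M U)ᴴ *ᵥ siteVec M y' u') (z, k) = 0 := fun k => by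
        have := congr_fun (congrArg ofLp h0) k
        simpa only [fib, WithLp.ofLp_toLp, WithLp.ofLp_zero, Pi.zero_apply] using this
      ext k
      rw [fib_apply, hg', Pi.smul_apply, smul_eq_mul, h0', mul_zero]; rfl
    exact ctW_le_on_block (L := L) M hδ0 y' T.root hbz
  have hfn : ‖(toLp 2 f : EuclideanSpace 𝕜 (Tor (fine L M) × n))‖ = ‖(toLp 2 u : EuclideanSpace 𝕜 n)‖ := norm_siteVec (fine L M) x u
  have hgn : ‖(toLp 2 g : EuclideanSpace 𝕜 (Tor (fine L M) × n))‖ = Real.sqrt ((L : ℝ) ^ (d + 1)) * ‖(toLp 2 u' : EuclideanSpace 𝕜 n)‖ := by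
    have h2 := norm_conjTranspose_covQ_mulVec_sq T M hU (siteVec M y' u')
    rw [norm_siteVec] at h2
    have hgn' : ‖(toLp 2 g : EuclideanSpace 𝕜 (Tor (fine L M) × n))‖ = (L : ℝ) ^ (d + 1) * ‖(toLp 2 ((covQ T M U)ᴴ *ᵥ siteVec M y' u') : EuclideanSpace 𝕜 (Tor (fine L M) × n))‖ := by
      rw [hg', WithLp.toLp_smul, norm_smul, RCLike.norm_ofReal, abs_of_pos hLr0]
    have hsq : ‖(toLp 2 g : EuclideanSpace 𝕜 (Tor (fine L M) × n))‖ ^ 2 = (Real.sqrt ((L : ℝ) ^ (d + 1)) * ‖(toLp 2 u' : EuclideanSpace 𝕜 n)‖) ^ 2 := by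
      rw [hgn', mul_pow, h2, mul_pow, Real.sq_sqrt hLr0.le]; field_simp
    exact (sq_eq_sq₀ (norm_nonneg _) (by positivity)).mp hsq
  rw [hpair]
  calc ‖star f ⬝ᵥ (G *ᵥ g)‖
      ≤ 2 / κ * ‖(toLp 2 (expWt (fine L M) (fun z => -ctW L M δ (site L M y' T.root) z) f) : EuclideanSpace 𝕜 (Tor (fine L M) × n))‖
          * ‖(toLp 2 (expWt (fine L M) (ctW L M δ (site L M y' T.root)) g) : EuclideanSpace 𝕜 (Tor (fine L M) × n))‖ := hD
    _ ≤ 2 / κ * (Real.exp (δ - δ * tdistT M (blockOf L M x) y') * ‖(toLp 2 f : EuclideanSpace 𝕜 (Tor (fine L M) × n))‖)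
          * (Real.exp δ * ‖(toLp 2 g : EuclideanSpace 𝕜 (Tor (fine L M) × n))‖) := by gcongr
    _ = 2 / κ * Real.sqrt ((L : ℝ) ^ (d + 1)) * (Real.exp (δ - δ * tdistT M (blockOf L M x) y') * Real.exp δ)
          * ‖(toLp 2 u : EuclideanSpace 𝕜 n)‖ * ‖(toLp 2 u' : EuclideanSpace 𝕜 n)‖ := by rw [hfn, hgn]; ring
    _ ≤ 2 / κ * Real.sqrt ((L : ℝ) ^ (d + 1)) * (Real.exp 2 * Real.exp (-(δ * tdistT M (blockOf L M x) y')))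
          * ‖(toLp 2 u : EuclideanSpace 𝕜 n)‖ * ‖(toLp 2 u' : EuclideanSpace 𝕜 n)‖ := by
        rw [← Real.exp_add, ← Real.exp_add]
        exact mul_le_mul_of_nonneg_right (mul_le_mul_of_nonneg_right
          (mul_le_mul_of_nonneg_left (Real.exp_le_exp.mpr (by linarith)) (by positivity)) (norm_nonneg _)) (norm_nonneg _)
    _ = 2 / κ * Real.sqrt ((L : ℝ) ^ (d + 1)) * Real.exp 2 * Real.exp (-(ctRate κ a d * tdistT M (blockOf L M x) y'))
          * ‖(toLp 2 u : EuclideanSpace 𝕜 n)‖ * ‖(toLp 2 u' : EuclideanSpace 𝕜 n)‖ := by ring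
end Minimiser

end Summit.QuantumFields.YangMills.BalabanUVNodes.N15KingModelRung.CombesThomas

end
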